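import Summits.NavierStokesRegularity.FluidComputer.PalasekTowerSlotSwirlBlob
import Literature.Analysis.FluidPDE.HarmonicMeanValueLocal

/-!
# The strict slot, II: Newton's shell theorem and the EXACT QUADRUPOLE PRESSURE of the swirl blob

Cell `ns-blowup`, seat `ns-palasek-19179-p2` (g0); second seat on the crux `EpisodeBaseG`
(item stmt-NavierStokesRegularity-19179) of the route `PalasekTowerBreakdown` — host-instance typing
(START-HERE-D0081 §C.3), sequel of `PalasekTowerSlotSwirlBlob.lean` (p455664). LABEL: E–C typing
(KERNEL calculus; theorems only, everything proved). WHAT THIS IS NOT: not Navier–Stokes evidence —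
potential theory of a PRESCRIBED profile; nothing about any flow, stage, `FirstEpisodeD`, `RungG 1`
or blow-up.

## What is here

* §4 `convolution_newtonKernel_eq_of_radial` — **Newton's shell theorem** (exterior form): for a
  continuous radial density `H` vanishing off `B(0, R)` and `‖x‖ > R`, `(H ⋆ Γ)(x) = (∫ H) Γ(x)`;
  from the tree's local weighted mean value property (`HarmonicMeanValueLocal`) applied to the
  smooth far kernel `Γ∞`.
* §5 `pot_sphSwirl_eq` — the pressure potential of the spherical swirl blob `W = f(‖y‖²) J y` is
  `π[W] = −H + ∂₂∂₂(H ⋆ Γ)` EVERYWHERE (`H = blobH f R²`; Green's representation `(ΔH) ⋆ Γ = H` and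
  derivatives commute with the convolution); hence (`pot_sphSwirl_eventuallyEq`) on the exterior
  `‖x‖ > R` the pressure is the EXACT quadrupole `π[W] = M ∂₂∂₂Γ`, `M = ∫ H`.
* §6 `fderiv3_newtonKernel_axis` — on the positive swirl axis `∂₂∂₂∂₂Γ(d e₂) = 3(2π)⁻¹ d⁻⁴`, and so
  (`fderiv_pot_sphSwirl_axis`) **`∂₂ π[W](d e₂) = 3M/(2π d⁴)`** for `d > R`: the pressure rises
  away from the blob along its axis, i.e. the axial pressure force points INTO the vortex. This is
  the one far-field number the strict anchor test of a composite design needs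
  (`Germ.anchor_test_iff_of_even_add_far`, `PalasekTowerGermHostSymmetry.lean`).

References: D. Gilbarg, N. S. Trudinger, *Elliptic PDE of second order* (2001), Thm 2.1,
(2.17)–(2.18), Lemma 4.1 [cite: GilbargTrudinger2001, Thm 2.1]; A. J. Majda, A. L. Bertozzi,
*Vorticity and Incompressible Flow* (CUP 2002), §1.8 Prop. 1.16 [cite: MajdaBertozziCUP2002, §1.8
Prop. 1.16].
-/

noncomputable section

namespace Summit.NavierStokesRegularity.FluidComputer.PalasekTowerClayBridge.Slot

open Set Function Filter Topology InnerProductSpace Metric MeasureTheory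
open scoped Topology ContDiff RealInnerProductSpace Laplacian

open Literature.Analysis.FluidPDE Literature.Analysis.FluidPDE.StrainedAzimuthal
open Summit.NavierStokesRegularity.FluidComputer.PalasekTowerClayBridge.Germ

variable {f f' : ℝ → ℝ}


/-! ## §4 Newton's shell theorem for a radial compactly supported density -/

section Shell

open scoped Convolution

/-- **NEWTON'S SHELL THEOREM** (exterior): for a continuous RADIAL density `H` vanishing off
`B(0, R)` and a point `x` with `‖x‖ > R`, the Newtonian potential is that of a point mass:
`(H ⋆ Γ)(x) = (∫ H) Γ(x)`. Proof: the weighted mean value property of the tree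
(`integral_radial_mul_eq_of_laplacian_eq_zero`) applied to the smooth far kernel `Γ∞(· − x)`,
which is harmonic on the ball carrying `H` and agrees with `Γ(x − ·)` there.
[cite: GilbargTrudinger2001, Thm 2.1] -/
theorem convolution_newtonKernel_eq_of_radial {H : EuclideanSpace ℝ (Fin 3) → ℝ}
    (hHc : Continuous H) (hrad : ∀ x y, ‖x‖ = ‖y‖ → H x = H y) {R : ℝ} (hR : 0 < R)
    (hH0 : ∀ y, R ≤ ‖y‖ → H y = 0) {x : EuclideanSpace ℝ (Fin 3)} (hx : R < ‖x‖) :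
    (H ⋆[ContinuousLinearMap.lsmul ℝ ℝ, volume] newtonKernel) x = (∫ y, H y) * newtonKernel x := by
  -- radii
  set δ : ℝ := ‖x‖ - R with hδ
  have hδ0 : 0 < δ := by rw [hδ]; linarith
  have h₀ : (0 : ℝ) < δ / 4 := by positivity
  have h₁ : δ / 4 < δ / 2 := by linarith
  -- the smooth far kernel centred at `x`
  set η : EuclideanSpace ℝ (Fin 3) → ℝ := fun z => newtonFar (δ / 4) (δ / 2) (-x + z) with hη
  have hηC : ContDiff ℝ 2 η :=
    (contDiff_newtonFar h₀ h₁ (n := 2)).comp ((contDiff_const).add contDiff_id)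
  -- harmonic on the ball `B(0, R + δ/4)`
  have hρ : 0 < R + δ / 4 := by positivity
  have hΔ : ∀ z ∈ ball (0 : EuclideanSpace ℝ (Fin 3)) (R + δ / 4), (Δ η) z = 0 := by
    intro z hz
    rw [mem_ball_zero_iff] at hz
    have hfar : δ / 2 < ‖-x + z‖ := by
      have h1 : ‖x‖ ≤ ‖-x + z‖ + ‖z‖ := by
        have := norm_add_le (-x + z) (-z)
        rw [show -x + z + -z = -x by abel, norm_neg, norm_neg] at this
        exact this
      linarith
    rw [hη, laplacian_comp_const_add (newtonFar (δ / 4) (δ / 2)) (-x) z]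
    exact newtonFarLaplacian_eq_zero_of_gt h₀.le h₁ hfar
  have hH0' : ∀ y : EuclideanSpace ℝ (Fin 3), R + δ / 4 ≤ ‖y‖ → H y = 0 :=
    fun y hy => hH0 y (by linarith)
  have key := integral_radial_mul_eq_of_laplacian_eq_zero hηC hρ (x₀ := 0)
    (by simpa using hΔ) hHc hH0' hrad
  -- identify both sides
  have hη0 : η 0 = newtonKernel x := by
    rw [hη]
    simp only [add_zero]
    rw [newtonFar_eq_newtonKernel h₀.le h₁ (by rw [norm_neg]; linarith), newtonKernel_neg]
  rw [convolution_newtonKernel_apply', ← hη0, ← key]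
  refine integral_congr_ae (Eventually.of_forall fun t => ?_)
  simp only [zero_add]
  by_cases ht : R ≤ ‖t‖
  · rw [hH0 t ht, mul_zero, zero_mul]
  · rw [not_le] at ht
    have hfar : δ / 2 ≤ ‖-x + t‖ := by
      have h1 : ‖x‖ ≤ ‖-x + t‖ + ‖t‖ := by
        have := norm_add_le (-x + t) (-t)
        rw [show -x + t + -t = -x by abel, norm_neg, norm_neg] at this
        exact this
      linarith
    rw [hη]
    simp only
    rw [newtonFar_eq_newtonKernel h₀.le h₁ hfar, show -x + t = -(x - t) by abel, newtonKernel_neg,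
      mul_comm]

/-- The shell theorem as a local identity of functions: near every exterior point,
`H ⋆ Γ = (∫ H) • Γ`. [cite: GilbargTrudinger2001, Thm 2.1] -/
theorem convolution_newtonKernel_eventuallyEq_of_radial {H : EuclideanSpace ℝ (Fin 3) → ℝ}
    (hHc : Continuous H) (hrad : ∀ x y, ‖x‖ = ‖y‖ → H x = H y) {R : ℝ} (hR : 0 < R)
    (hH0 : ∀ y, R ≤ ‖y‖ → H y = 0) {x : EuclideanSpace ℝ (Fin 3)} (hx : R < ‖x‖) :
    (H ⋆[ContinuousLinearMap.lsmul ℝ ℝ, volume] newtonKernel) =ᶠ[𝓝 x]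
      fun z => (∫ y, H y) * newtonKernel z := by
  have hopen : IsOpen {z : EuclideanSpace ℝ (Fin 3) | R < ‖z‖} :=
    isOpen_lt continuous_const continuous_norm
  filter_upwards [hopen.mem_nhds hx] with z hz
  exact convolution_newtonKernel_eq_of_radial hHc hrad hR hH0 hz

end Shell

/-! ## §5 The pressure potential of the blob: `π = −H + ∂₂²(H ⋆ Γ)` -/

section Pressure

open scoped Convolution

variable {R : ℝ} (hfs : ContDiff ℝ ∞ f) (hf : ∀ u, HasDerivAt f (f' u) u) (hR : 0 < R)
  (hfR : ∀ u, R ^ 2 ≤ u → f u = 0)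
include hfs hf hR hfR

/-- **THE PRESSURE POTENTIAL OF THE BLOB**: `π[W](x) = −H(x) + ∂₂∂₂(H ⋆ Γ)(x)` for every `x`,
`H = blobH f R²` (`(ΔH) ⋆ Γ = H` by Green's representation, and two derivatives commute with the
convolution). [cite: GilbargTrudinger2001, (2.17)–(2.18) and Lemma 4.1] -/
theorem pot_sphSwirl_eq (ν : ℝ) (x : EuclideanSpace ℝ (Fin 3)) :
    pot ν (sphSwirl f) x =
      -blobH f (R ^ 2) x +
        fderiv ℝ (fun z => fderiv ℝ
          (blobH f (R ^ 2) ⋆[ContinuousLinearMap.lsmul ℝ ℝ, volume] newtonKernel) z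
            (EuclideanSpace.single 2 1)) x (EuclideanSpace.single 2 1) := by
  set e : EuclideanSpace ℝ (Fin 3) := EuclideanSpace.single 2 1 with he
  set H := blobH f (R ^ 2) with hH
  have hHs : ContDiff ℝ ∞ H := contDiff_blobH hfs _
  have hHc : HasCompactSupport H := hasCompactSupport_blobH hR.le hfR
  -- the two pieces of the source
  set D : EuclideanSpace ℝ (Fin 3) → ℝ := fun y => fderiv ℝ (fun z => fderiv ℝ H z e) y e with hD
  set H₁ : EuclideanSpace ℝ (Fin 3) → ℝ := fun z => fderiv ℝ H z e with hH₁
  have hH₁s : ContDiff ℝ ∞ H₁ := (hHs.fderiv_right (m := ∞) le_rfl).clm_apply contDiff_const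
  have hH₁c : HasCompactSupport H₁ := hHc.fderiv_apply (𝕜 := ℝ) e
  have hDs : ContDiff ℝ ∞ D := (hH₁s.fderiv_right (m := ∞) le_rfl).clm_apply contDiff_const
  have hDc : HasCompactSupport D := hH₁c.fderiv_apply (𝕜 := ℝ) e
  have hΔs : ContDiff ℝ ∞ (Δ H) :=
    contDiff_infty.2 fun n => contDiff_laplacian (n := n) (contDiff_infty.1 hHs (n + 2))
  have hΔc : HasCompactSupport (Δ H) := hHc.mono' fun x hx => by
    by_contra h
    exact hx (laplacian_eq_zero_of_notMem_tsupport h)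
  -- the source as a function
  set S₁ : EuclideanSpace ℝ (Fin 3) → ℝ := fun y => -(Δ H) y with hS₁
  have hsrc : VectorCalculus.divergence (drift ν (sphSwirl f)) = S₁ + D := by
    funext y
    rw [Pi.add_apply, hS₁, hD]
    exact divergence_drift_sphSwirl_eq_blobH hfs hf ν (R ^ 2) y
  have hloc := NewtonPotentialRepresentation.locallyIntegrable_newtonKernel
  have hex1 : ConvolutionExistsAt S₁ newtonKernel x (ContinuousLinearMap.lsmul ℝ ℝ) volume :=
    (hΔc.neg.convolutionExists_left _ hΔs.continuous.neg hloc) x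
  have hex2 : ConvolutionExistsAt D newtonKernel x (ContinuousLinearMap.lsmul ℝ ℝ) volume :=
    (hDc.convolutionExists_left _ hDs.continuous hloc) x
  rw [pot, divPotential, hsrc, hex1.add_distrib hex2]
  -- `(−ΔH) ⋆ Γ = −H`
  have h1 : (S₁ ⋆[ContinuousLinearMap.lsmul ℝ ℝ, volume] newtonKernel) x = -H x := by
    have hS : S₁ = (-1 : ℝ) • (Δ H) := by funext y; simp [hS₁]
    rw [hS, smul_convolution, Pi.smul_apply, convolution_newtonKernel_apply', smul_eq_mul,
      integral_newtonKernel_mul_laplacian (hHs.of_le (by norm_cast)) hHc x]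
    ring
  -- `D ⋆ Γ = ∂₂∂₂ (H ⋆ Γ)`
  have h2 : (D ⋆[ContinuousLinearMap.lsmul ℝ ℝ, volume] newtonKernel) x =
      fderiv ℝ (fun z => fderiv ℝ (H ⋆[ContinuousLinearMap.lsmul ℝ ℝ, volume] newtonKernel) z e)
        x e := by
    have hstep1 : (fun z => fderiv ℝ (H ⋆[ContinuousLinearMap.lsmul ℝ ℝ, volume] newtonKernel) z e)
        = H₁ ⋆[ContinuousLinearMap.lsmul ℝ ℝ, volume] newtonKernel := by
      funext z
      exact fderiv_convolution_newtonKernel_apply (hHs.of_le (by norm_cast)) hHc z e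
    rw [hstep1, fderiv_convolution_newtonKernel_apply (hH₁s.of_le (by norm_cast)) hH₁c x e]
  rw [h1, h2]

/-- **THE EXTERIOR PRESSURE OF THE BLOB IS AN EXACT QUADRUPOLE**: near every `x` with `‖x‖ > R`,
`π[W] = M ∂₂∂₂Γ` with `M = ∫ H` (shell theorem; `H = 0` there).
[cite: GilbargTrudinger2001, Thm 2.1] -/
theorem pot_sphSwirl_eventuallyEq (ν : ℝ) {x : EuclideanSpace ℝ (Fin 3)} (hx : R < ‖x‖) :
    pot ν (sphSwirl f) =ᶠ[𝓝 x] fun z =>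
      (∫ y, blobH f (R ^ 2) y) *
        fderiv ℝ (fun w => fderiv ℝ newtonKernel w (EuclideanSpace.single 2 1)) z
          (EuclideanSpace.single 2 1) := by
  have hHcont : Continuous (blobH f (R ^ 2)) := (contDiff_blobH hfs _).continuous
  have hrad : ∀ x y : EuclideanSpace ℝ (Fin 3), ‖x‖ = ‖y‖ →
      blobH f (R ^ 2) x = blobH f (R ^ 2) y := fun x y hxy => by
    simp only [blobH, hxy]
  have hH0 : ∀ y : EuclideanSpace ℝ (Fin 3), R ≤ ‖y‖ → blobH f (R ^ 2) y = 0 := fun y hy =>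
    blobH_eq_zero_of_le hR.le hfR hy
  have hopen : IsOpen {z : EuclideanSpace ℝ (Fin 3) | R < ‖z‖} :=
    isOpen_lt continuous_const continuous_norm
  -- on the open exterior `H ⋆ Γ = M Γ`, hence the same for the directional derivative along `e₂`
  have hD1 : ∀ z ∈ {z : EuclideanSpace ℝ (Fin 3) | R < ‖z‖},
      (fun w => fderiv ℝ (blobH f (R ^ 2) ⋆[ContinuousLinearMap.lsmul ℝ ℝ, volume] newtonKernel) w
        (EuclideanSpace.single 2 1)) =ᶠ[𝓝 z]
        fun w => (∫ y, blobH f (R ^ 2) y) *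
          fderiv ℝ newtonKernel w (EuclideanSpace.single 2 1) := by
    intro z hz
    filter_upwards [hopen.eventually_mem hz] with w hw
    rw [(convolution_newtonKernel_eventuallyEq_of_radial hHcont hrad hR hH0 hw).fderiv_eq]
    have hw0 : w ≠ 0 := norm_pos_iff.mp (hR.trans hw)
    rw [show (fun w => (∫ y, blobH f (R ^ 2) y) * newtonKernel w) =
        fun w => (∫ y, blobH f (R ^ 2) y) • newtonKernel w from rfl,
      fderiv_fun_const_smul ((contDiffAt_newtonKernel hw0 (n := 1)).differentiableAt one_ne_zero)]
    simp
  filter_upwards [hopen.mem_nhds hx] with z hz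
  rw [pot_sphSwirl_eq hfs hf hR hfR ν z, hH0 z hz.le, neg_zero, zero_add, (hD1 z hz).fderiv_eq]
  have hz0 : z ≠ 0 := norm_pos_iff.mp (hR.trans hz)
  have hdiff : DifferentiableAt ℝ
      (fun w => fderiv ℝ newtonKernel w (EuclideanSpace.single 2 1)) z :=
    (((contDiffOn_fderiv_newtonKernel (n := 1)).differentiableOn one_ne_zero).differentiableAt
      (isOpen_compl_singleton.mem_nhds hz0)).clm_apply (differentiableAt_const _)
  rw [show (fun w => (∫ y, blobH f (R ^ 2) y) *
        fderiv ℝ newtonKernel w (EuclideanSpace.single 2 1)) =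
      fun w => (∫ y, blobH f (R ^ 2) y) • fderiv ℝ newtonKernel w (EuclideanSpace.single 2 1)
      from rfl, fderiv_fun_const_smul hdiff]
  simp

end Pressure


/-! ## §6 The axial third derivative of `Γ` and the pressure gradient on the axis -/

section Axis

/-- `⟪z, e₂⟫ = z₂`. [folklore] -/
private theorem inner_single_two (z : EuclideanSpace ℝ (Fin 3)) :
    ⟪z, EuclideanSpace.single 2 (1 : ℝ)⟫ = z 2 := by
  rw [EuclideanSpace.inner_single_right]; simp

/-- Off the origin, `∂₂Γ(w) = 2 γ₁(‖w‖²) w₂`. [folklore] -/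
theorem fderiv_newtonKernel_single_two {w : EuclideanSpace ℝ (Fin 3)} (hw : w ≠ 0) :
    fderiv ℝ newtonKernel w (EuclideanSpace.single 2 1) = 2 * newtonProfile₁ (‖w‖ ^ 2) * w 2 := by
  have hσ : 0 < ‖w‖ ^ 2 := by positivity
  change fderiv ℝ (fun z : EuclideanSpace ℝ (Fin 3) => newtonProfile (‖z‖ ^ 2)) w _ = _
  rw [fderiv_comp_norm_sq_apply (hasDerivAt_newtonProfile hσ), inner_single_two]

/-- Off the origin, `∂₂∂₂Γ(z) = 4 γ₂(‖z‖²) z₂² + 2 γ₁(‖z‖²)`. [folklore] -/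
theorem fderiv_fderiv_newtonKernel_single_two {z : EuclideanSpace ℝ (Fin 3)} (hz : z ≠ 0) :
    fderiv ℝ (fun w => fderiv ℝ newtonKernel w (EuclideanSpace.single 2 1)) z
        (EuclideanSpace.single 2 1) =
      4 * newtonProfile₂ (‖z‖ ^ 2) * z 2 ^ 2 + 2 * newtonProfile₁ (‖z‖ ^ 2) := by
  have hσ : 0 < ‖z‖ ^ 2 := by positivity
  -- replace the inner derivative by its closed form near `z`
  have hev : (fun w => fderiv ℝ newtonKernel w (EuclideanSpace.single 2 1)) =ᶠ[𝓝 z]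
      fun w => 2 * newtonProfile₁ (‖w‖ ^ 2) * w 2 := by
    filter_upwards [isOpen_compl_singleton.mem_nhds hz] with w hw
    exact fderiv_newtonKernel_single_two hw
  rw [hev.fderiv_eq]
  have h1 : HasFDerivAt (fun w : EuclideanSpace ℝ (Fin 3) => 2 * newtonProfile₁ (‖w‖ ^ 2))
      ((2 * (2 * newtonProfile₂ (‖z‖ ^ 2))) •
        (innerSL ℝ z : EuclideanSpace ℝ (Fin 3) →L[ℝ] ℝ)) z := by
    have h := (hasFDerivAt_comp_norm_sq (hasDerivAt_newtonProfile₁ hσ)).const_mul (2 : ℝ)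
    refine h.congr_fderiv ?_
    rw [smul_smul]
  have h2 : HasFDerivAt (fun w : EuclideanSpace ℝ (Fin 3) => w 2) (proj 2) z := (proj 2).hasFDerivAt
  rw [(h1.fun_mul h2).fderiv]
  simp only [_root_.add_apply, _root_.smul_apply, smul_eq_mul, PiLp.proj_apply,
    innerSL_real_coe_apply_apply, inner_single_two]
  simp
  ring

/-- On the positive `e₂`-axis, `∂₂∂₂Γ(s e₂) = −(2π)⁻¹ s⁻³`. [folklore] -/
theorem fderiv_fderiv_newtonKernel_axis {s : ℝ} (hs : 0 < s) :
    fderiv ℝ (fun w => fderiv ℝ newtonKernel w (EuclideanSpace.single 2 1))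
        (s • EuclideanSpace.single 2 (1 : ℝ)) (EuclideanSpace.single 2 1) =
      -(2 * Real.pi)⁻¹ * (s ^ 3)⁻¹ := by
  have hne : s • EuclideanSpace.single (2 : Fin 3) (1 : ℝ) ≠ 0 := by
    rw [smul_ne_zero_iff]
    exact ⟨hs.ne', by
      intro h
      have := congrArg (fun v : EuclideanSpace ℝ (Fin 3) => v 2) h
      simp at this⟩
  rw [fderiv_fderiv_newtonKernel_single_two hne]
  have hn : ‖s • EuclideanSpace.single (2 : Fin 3) (1 : ℝ)‖ = s := by
    rw [norm_smul, PiLp.norm_single, norm_one, mul_one, Real.norm_eq_abs, abs_of_pos hs]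
  have hc : (s • EuclideanSpace.single (2 : Fin 3) (1 : ℝ)) 2 = s := by simp
  rw [hn, hc, newtonProfile₂, newtonProfile₁]
  have h5 : (s ^ 2) ^ (-(5 / 2 : ℝ)) = (s ^ 5)⁻¹ := by
    rw [show (s ^ 2 : ℝ) = s ^ (2 : ℝ) by norm_cast, ← Real.rpow_mul hs.le,
      show (2 : ℝ) * -(5 / 2) = -(5 : ℕ) by norm_num, Real.rpow_neg hs.le, Real.rpow_natCast]
  have h3 : (s ^ 2) ^ (-(3 / 2 : ℝ)) = (s ^ 3)⁻¹ := by
    rw [show (s ^ 2 : ℝ) = s ^ (2 : ℝ) by norm_cast, ← Real.rpow_mul hs.le,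
      show (2 : ℝ) * -(3 / 2) = -(3 : ℕ) by norm_num, Real.rpow_neg hs.le, Real.rpow_natCast]
  rw [h5, h3]
  have hs0 : s ≠ 0 := hs.ne'
  field_simp
  ring

/-- The function `∂₂∂₂Γ` is differentiable off the origin. [folklore] -/
theorem differentiableAt_fderiv_fderiv_newtonKernel {z : EuclideanSpace ℝ (Fin 3)} (hz : z ≠ 0) :
    DifferentiableAt ℝ (fun x =>
      fderiv ℝ (fun w => fderiv ℝ newtonKernel w (EuclideanSpace.single 2 1))
        x (EuclideanSpace.single 2 1)) z := by
  -- near `z`, `∂₂∂₂Γ` is the closed form, which is differentiable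
  have hev : (fun x => fderiv ℝ (fun w => fderiv ℝ newtonKernel w (EuclideanSpace.single 2 1)) x
      (EuclideanSpace.single 2 1)) =ᶠ[𝓝 z]
      fun x => 4 * newtonProfile₂ (‖x‖ ^ 2) * x 2 ^ 2 + 2 * newtonProfile₁ (‖x‖ ^ 2) := by
    filter_upwards [isOpen_compl_singleton.mem_nhds hz] with x hx
    exact fderiv_fderiv_newtonKernel_single_two hx
  refine DifferentiableAt.congr_of_eventuallyEq ?_ hev
  have hσ : 0 < ‖z‖ ^ 2 := by positivity
  have hγ₂ : DifferentiableAt ℝ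
      (fun x : EuclideanSpace ℝ (Fin 3) => newtonProfile₂ (‖x‖ ^ 2)) z := by
    have h' : HasDerivAt newtonProfile₂
        (-(3 / (16 * Real.pi)) * (-(5 / 2 : ℝ) * (‖z‖ ^ 2) ^ (-(5 / 2 : ℝ) - 1))) (‖z‖ ^ 2) := by
      unfold newtonProfile₂
      exact (Real.hasDerivAt_rpow_const (p := -(5 / 2 : ℝ)) (Or.inl hσ.ne')).const_mul _
    exact (hasFDerivAt_comp_norm_sq h').differentiableAt
  have hγ₁ : DifferentiableAt ℝ (fun x : EuclideanSpace ℝ (Fin 3) => newtonProfile₁ (‖x‖ ^ 2)) z :=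
    (hasFDerivAt_comp_norm_sq (hasDerivAt_newtonProfile₁ hσ)).differentiableAt
  have h2 : DifferentiableAt ℝ (fun x : EuclideanSpace ℝ (Fin 3) => x 2) z :=
    (proj 2).differentiableAt
  exact ((hγ₂.const_mul _).mul (h2.pow 2)).add (hγ₁.const_mul _)

/-- **THE AXIAL THIRD DERIVATIVE**: on the positive `e₂`-axis,
`∂₂∂₂∂₂Γ(d e₂) = 3 (2π)⁻¹ d⁻⁴`. [folklore] -/
theorem fderiv3_newtonKernel_axis {d : ℝ} (hd : 0 < d) :
    fderiv ℝ (fun x => fderiv ℝ (fun w => fderiv ℝ newtonKernel w (EuclideanSpace.single 2 1))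
      x (EuclideanSpace.single 2 1)) (d • EuclideanSpace.single 2 (1 : ℝ))
      (EuclideanSpace.single 2 1) = 3 * (2 * Real.pi)⁻¹ * (d ^ 4)⁻¹ := by
  set e : EuclideanSpace ℝ (Fin 3) := EuclideanSpace.single 2 (1 : ℝ) with he
  set G : EuclideanSpace ℝ (Fin 3) → ℝ := fun x =>
    fderiv ℝ (fun w => fderiv ℝ newtonKernel w e) x e with hG
  have hne : d • e ≠ 0 := by
    rw [smul_ne_zero_iff]
    exact ⟨hd.ne', by
      intro h
      have := congrArg (fun v : EuclideanSpace ℝ (Fin 3) => v 2) h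
      simp [he] at this⟩
  -- chain rule along the line `s ↦ s • e`
  have hline : HasDerivAt (fun s : ℝ => s • e) e d := by
    simpa using (hasDerivAt_id d).smul_const e
  have hGd : DifferentiableAt ℝ G (d • e) := differentiableAt_fderiv_fderiv_newtonKernel hne
  have hcomp : HasDerivAt (G ∘ fun s : ℝ => s • e) (fderiv ℝ G (d • e) e) d :=
    hGd.hasFDerivAt.comp_hasDerivAt d hline
  rw [← hcomp.deriv, show (G ∘ fun s : ℝ => s • e) = fun s => G (s • e) from rfl]
  -- along the axis `G(s e) = −(2π)⁻¹ s⁻³` near `d`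
  have hev : (fun s : ℝ => G (s • e)) =ᶠ[𝓝 d] fun s => -(2 * Real.pi)⁻¹ * (s ^ 3)⁻¹ := by
    filter_upwards [(isOpen_lt continuous_const continuous_id).mem_nhds hd] with s hs
    exact fderiv_fderiv_newtonKernel_axis hs
  rw [hev.deriv_eq]
  have hd0 : d ≠ 0 := hd.ne'
  have hderiv : HasDerivAt (fun s : ℝ => -(2 * Real.pi)⁻¹ * (s ^ 3)⁻¹)
      (-(2 * Real.pi)⁻¹ * (-(3 * d ^ 2) / (d ^ 3) ^ 2)) d := by
    have h1 : HasDerivAt (fun s : ℝ => s ^ 3) (3 * d ^ 2) d := by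
      simpa using hasDerivAt_pow 3 d
    have h2 := h1.inv (pow_ne_zero 3 hd0)
    exact h2.const_mul _
  rw [hderiv.deriv]
  field_simp

variable {R : ℝ} (hfs : ContDiff ℝ ∞ f) (hf : ∀ u, HasDerivAt f (f' u) u) (hR : 0 < R)
  (hfR : ∀ u, R ^ 2 ≤ u → f u = 0)
include hfs hf hR hfR

/-- **THE PRESSURE GRADIENT OF THE BLOB ON ITS AXIS**: at the exterior axis point `d e₂`
(`d > R`), `∂₂ π[W](d e₂) = M · 3 (2π)⁻¹ d⁻⁴` with `M = ∫ H` — the pressure INCREASES away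
from the blob along its swirl axis (axial suction towards the vortex).
[cite: GilbargTrudinger2001, Thm 2.1] -/
theorem fderiv_pot_sphSwirl_axis (ν : ℝ) {d : ℝ} (hd : R < d) :
    fderiv ℝ (pot ν (sphSwirl f)) (d • EuclideanSpace.single 2 (1 : ℝ))
      (EuclideanSpace.single 2 1) =
      (∫ y, blobH f (R ^ 2) y) * (3 * (2 * Real.pi)⁻¹ * (d ^ 4)⁻¹) := by
  have hd0 : 0 < d := hR.trans hd
  have hnorm : R < ‖d • EuclideanSpace.single (2 : Fin 3) (1 : ℝ)‖ := by
    rw [norm_smul, PiLp.norm_single, norm_one, mul_one, Real.norm_eq_abs, abs_of_pos hd0]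
    exact hd
  have hne : d • EuclideanSpace.single (2 : Fin 3) (1 : ℝ) ≠ 0 := norm_pos_iff.mp (hR.trans hnorm)
  rw [(pot_sphSwirl_eventuallyEq hfs hf hR hfR ν hnorm).fderiv_eq,
    fderiv_const_mul (differentiableAt_fderiv_fderiv_newtonKernel hne)]
  rw [show ∀ (c : ℝ) (L : EuclideanSpace ℝ (Fin 3) →L[ℝ] ℝ) (v : EuclideanSpace ℝ (Fin 3)),
      (c • L) v = c * L v from fun c L v => rfl, fderiv3_newtonKernel_axis hd0]

end Axis

end Summit.NavierStokesRegularity.FluidComputer.PalasekTowerClayBridge.Slot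

end
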